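import Literature.Analysis.Calculus.LineIntegrationBootstrap   -- ★ p846444 (d1): `norm_le_of_norm_lineDeriv_le_inv_pow`, `_le_inv`, `_le_log`, `linearForm_add_smul`
import HarnessLib

/-!
# Line-integration bootstrap, ITERATED: a family closed under `∂_e` with a UNIFORM polynomial loss at a wall is bounded up to the transverse weight (Harish-Chandra ∕ Warner II §8.4.3)

Topic `Analysis/Calculus`; namespace `Literature.Analysis.Calculus.LineBootstrap`.  THEOREMS ONLY (no `def`, no instance, no notation, no axiom, no named fact, no `sorry`).
Cell `pub/hodgecm-mathlib`, ENGINE T1 (crux H413 = `stmt-HodgeConjecture-24833`); ROAD «A6-IV» (owner∕architect F0P3a-p05 (g15), DESIGN «(A6) IN-HOUSE» v2 = ARCHITECTURE (IV)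
93542b84b04a2b0a, brick **(d1′)** = the GENERIC ENGINE of (d2) «JET-BOUND BOOTSTRAP» [M, generic] over ★ (d1) p846444; LEAD F0P3a-plan (g12) T11-13; pen F0P3a-p02 (g14), 2026-09-01).

THE MATHEMATICS [WarnerHASSLG2, §8.4.3, proof of Thm. 8.4.3.1; HC 1957].  `V` a real vector space, `β : V → ℝ` linear (distance to ONE wall), `e ∈ V` with `β e = 1` (the direction away from the wall);
`T ⊆ {0 < β ≤ 1}` a region closed under the EXIT SEGMENTS `θ + s•e`, `0 ≤ s ≤ 1 − β θ` (the exit point lies on the level `β = 1`); `W : V → ℝ≥0` a TRANSVERSE WEIGHT, non-increasing along the exit segments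
(in the application `W = β′^{−ρ′}` for the second wall `β′`, `β′ e ≥ 0`).  A FAMILY `v : ι → V → E` CLOSED UNDER `∂_e`: `s ↦ v i (θ + s•e)` has derivative `v (next i) (θ + s•e)` on the segments.
UNIFORM LOSS `k`: `P k ≡ ∀ i, ∃ M ≥ 0, ∀ θ ∈ T, ‖v i θ‖ ≤ M·(β θ)^{−k}·W θ`; logarithmic loss `P_log ≡ … ≤ M·(1 + |log β θ|)·W θ`.
§1 one pass each (★ (d1) along the segment, exit value bounded by the a-priori bound at `β = 1`): (A) `P (n+2) ⟹ P (n+1)`, (B) `P 1 ⟹ P_log`, (C) `P_log ⟹ P 0`;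
§2 **THE BOOTSTRAP** `P n ⟹ P 0` (induction on `n`): a uniform polynomial loss for a `∂_e`-closed family is NO loss; §3 the TWO-WALL corollary: losses `β^{−n}·β′^{−n′}` on a region closed under both
exit families, `β′` non-decreasing along `e` (nothing is asked of `β` along `e′`) ⟹ every member is BOUNDED on `T` — Warner's induction for `{∂(q)φ_f}` on a sector chamber once the loss is uniform in `q`
(on `U(2,1)`: (b3)+(e) make it so; this file is the analysis, with no Lie theory in it).
HONEST LABEL: HC_CM is proved only modulo the printed citations until rung 0 closes; generic calculus, pays nothing by itself.

* [WarnerHASSLG2] G. Warner, *Harmonic Analysis on Semi-Simple Lie Groups II* (1972), §8.4.3, Thm. 8.4.3.1 (proof: «we now integrate along the line … and use induction on r»).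
* [Rudin1976] W. Rudin, *Principles of Mathematical Analysis*, 3rd ed. (1976), Thm. 5.19 (vector mean value inequality).
-/

noncomputable section

open Set

namespace Literature.Analysis.Calculus.LineBootstrap

variable {V : Type*} [AddCommGroup V] [Module ℝ V] {E : Type*} [NormedAddCommGroup E] [NormedSpace ℝ E] {ι : Type*}

/-! ### §1 One pass each: power ↦ power, first power ↦ logarithm, logarithm ↦ bounded -/

section OnePass

/-- For `0 < b ≤ 1`: `1 ≤ (b ^ k)⁻¹`. [cite: Rudin1976, Thm. 5.19] -/
theorem one_le_inv_pow_of_le_one {b : ℝ} (hb : 0 < b) (hb1 : b ≤ 1) (k : ℕ) : 1 ≤ (b ^ k)⁻¹ :=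
  one_le_inv_iff₀.2 ⟨pow_pos hb k, pow_le_one₀ hb.le hb1⟩

/-- **(A) ONE POWER PASS `P (n+2) ⟹ P (n+1)`.**  Region `T ⊆ {0 < β ≤ 1}` closed under the exit segments; weight `W ≥ 0` non-increasing along them; `s ↦ v (θ + s•e)` has derivative `w (θ + s•e)`;
if `‖w‖ ≤ M·β^{−(n+2)}·W` and `‖v‖ ≤ M₀·β^{−(n+2)}·W` on `T` (the latter only used at the exit level `β = 1`), then `‖v‖ ≤ (M₀ + M∕(n+1))·β^{−(n+1)}·W` on `T`.
[cite: WarnerHASSLG2, §8.4.3 (proof of Thm. 8.4.3.1)] -/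
theorem norm_le_inv_pow_weight_of_lineDeriv (v w : V → E) (β : V →ₗ[ℝ] ℝ) (e : V) (hβe : β e = 1) (T : Set V) (hT : ∀ θ ∈ T, 0 < β θ ∧ β θ ≤ 1)
    (hseg : ∀ θ ∈ T, ∀ s ∈ Icc (0 : ℝ) (1 - β θ), θ + s • e ∈ T) (W : V → ℝ) (hW0 : ∀ θ ∈ T, 0 ≤ W θ)
    (hWmono : ∀ θ ∈ T, ∀ s ∈ Icc (0 : ℝ) (1 - β θ), W (θ + s • e) ≤ W θ)
    (hv : ∀ θ ∈ T, ∀ s ∈ Icc (0 : ℝ) (1 - β θ), HasDerivAt (fun s : ℝ => v (θ + s • e)) (w (θ + s • e)) s)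
    (n : ℕ) {M₀ M : ℝ} (hM₀ : 0 ≤ M₀) (hM : 0 ≤ M) (hv0 : ∀ θ ∈ T, ‖v θ‖ ≤ M₀ * ((β θ) ^ (n + 2))⁻¹ * W θ)
    (hw : ∀ θ ∈ T, ‖w θ‖ ≤ M * ((β θ) ^ (n + 2))⁻¹ * W θ) :
    ∀ θ ∈ T, ‖v θ‖ ≤ (M₀ + M / (n + 1)) * ((β θ) ^ (n + 1))⁻¹ * W θ := by
  intro θ hθ
  obtain ⟨hb, hb1⟩ := hT θ hθ
  have hWθ := hW0 θ hθ
  set S : ℝ := 1 - β θ with hSdef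
  have hS : 0 ≤ S := by linarith
  -- the derivative bound along the segment, with the weight frozen at `θ`
  have bound : ∀ s ∈ Icc (0 : ℝ) S, ‖w (θ + s • e)‖ ≤ M * W θ * ((β (θ + s • e)) ^ (n + 2))⁻¹ := by
    intro s hs
    have hmem := hseg θ hθ s hs
    refine (hw _ hmem).trans ?_
    have hpos : 0 ≤ ((β (θ + s • e)) ^ (n + 2))⁻¹ := inv_nonneg.2 (pow_nonneg (hT _ hmem).1.le _)
    calc M * ((β (θ + s • e)) ^ (n + 2))⁻¹ * W (θ + s • e) ≤ M * ((β (θ + s • e)) ^ (n + 2))⁻¹ * W θ :=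
          mul_le_mul_of_nonneg_left (hWmono θ hθ s hs) (mul_nonneg hM hpos)
      _ = M * W θ * ((β (θ + s • e)) ^ (n + 2))⁻¹ := by ring
  have h1 := norm_le_of_norm_lineDeriv_le_inv_pow v w β θ e n hβe hb hS (mul_nonneg hM hWθ) (hv θ hθ) bound
  -- the exit value: `β (θ + S•e) = 1`
  have hexit_mem : θ + S • e ∈ T := hseg θ hθ S ⟨hS, le_rfl⟩
  have hβexit : β (θ + S • e) = 1 := by rw [linearForm_add_smul β θ e hβe, hSdef]; ring
  have h2 : ‖v (θ + S • e)‖ ≤ M₀ * W θ := by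
    refine (hv0 _ hexit_mem).trans ?_
    rw [hβexit, one_pow, inv_one, mul_one]
    exact mul_le_mul_of_nonneg_left (hWmono θ hθ S ⟨hS, le_rfl⟩) hM₀
  have hinv : 1 ≤ ((β θ) ^ (n + 1))⁻¹ := one_le_inv_pow_of_le_one hb hb1 (n + 1)
  have h3 : M₀ * W θ ≤ M₀ * ((β θ) ^ (n + 1))⁻¹ * W θ := by
    have := mul_le_mul_of_nonneg_left hinv (mul_nonneg hM₀ hWθ)
    calc M₀ * W θ = M₀ * W θ * 1 := (mul_one _).symm
      _ ≤ M₀ * W θ * ((β θ) ^ (n + 1))⁻¹ := this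
      _ = M₀ * ((β θ) ^ (n + 1))⁻¹ * W θ := by ring
  calc ‖v θ‖ ≤ ‖v (θ + S • e)‖ + M * W θ / (n + 1) * ((β θ) ^ (n + 1))⁻¹ := h1
    _ ≤ M₀ * ((β θ) ^ (n + 1))⁻¹ * W θ + M * W θ / (n + 1) * ((β θ) ^ (n + 1))⁻¹ := by linarith
    _ = (M₀ + M / (n + 1)) * ((β θ) ^ (n + 1))⁻¹ * W θ := by ring

/-- **(B) THE FIRST-POWER PASS `P 1 ⟹ P_log`.**  Same setting; if `‖w‖ ≤ M·β⁻¹·W` and `‖v‖ ≤ M₀·β⁻¹·W` on `T`, then `‖v‖ ≤ (M₀ + 2M)·(1 + |log β|)·W` on `T`.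
[cite: WarnerHASSLG2, §8.4.3 (proof of Thm. 8.4.3.1)] -/
theorem norm_le_log_weight_of_lineDeriv (v w : V → E) (β : V →ₗ[ℝ] ℝ) (e : V) (hβe : β e = 1) (T : Set V) (hT : ∀ θ ∈ T, 0 < β θ ∧ β θ ≤ 1)
    (hseg : ∀ θ ∈ T, ∀ s ∈ Icc (0 : ℝ) (1 - β θ), θ + s • e ∈ T) (W : V → ℝ) (hW0 : ∀ θ ∈ T, 0 ≤ W θ)
    (hWmono : ∀ θ ∈ T, ∀ s ∈ Icc (0 : ℝ) (1 - β θ), W (θ + s • e) ≤ W θ)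
    (hv : ∀ θ ∈ T, ∀ s ∈ Icc (0 : ℝ) (1 - β θ), HasDerivAt (fun s : ℝ => v (θ + s • e)) (w (θ + s • e)) s)
    {M₀ M : ℝ} (hM₀ : 0 ≤ M₀) (hM : 0 ≤ M) (hv0 : ∀ θ ∈ T, ‖v θ‖ ≤ M₀ * (β θ)⁻¹ * W θ)
    (hw : ∀ θ ∈ T, ‖w θ‖ ≤ M * (β θ)⁻¹ * W θ) :
    ∀ θ ∈ T, ‖v θ‖ ≤ (M₀ + 2 * M) * (1 + |Real.log (β θ)|) * W θ := by
  intro θ hθ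
  obtain ⟨hb, hb1⟩ := hT θ hθ
  have hWθ := hW0 θ hθ
  set S : ℝ := 1 - β θ with hSdef
  have hS : 0 ≤ S := by linarith
  have bound : ∀ s ∈ Icc (0 : ℝ) S, ‖w (θ + s • e)‖ ≤ M * W θ * (β (θ + s • e))⁻¹ := by
    intro s hs
    have hmem := hseg θ hθ s hs
    refine (hw _ hmem).trans ?_
    have hpos : 0 ≤ (β (θ + s • e))⁻¹ := inv_nonneg.2 (hT _ hmem).1.le
    calc M * (β (θ + s • e))⁻¹ * W (θ + s • e) ≤ M * (β (θ + s • e))⁻¹ * W θ :=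
          mul_le_mul_of_nonneg_left (hWmono θ hθ s hs) (mul_nonneg hM hpos)
      _ = M * W θ * (β (θ + s • e))⁻¹ := by ring
  have h1 := norm_le_of_norm_lineDeriv_le_inv v w β θ e hβe hb hS (mul_nonneg hM hWθ) (hv θ hθ) bound
  have hexit_mem : θ + S • e ∈ T := hseg θ hθ S ⟨hS, le_rfl⟩
  have hβexit : β (θ + S • e) = 1 := by rw [linearForm_add_smul β θ e hβe, hSdef]; ring
  have h2 : ‖v (θ + S • e)‖ ≤ M₀ * W θ := by
    refine (hv0 _ hexit_mem).trans ?_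
    rw [hβexit, inv_one, mul_one]
    exact mul_le_mul_of_nonneg_left (hWmono θ hθ S ⟨hS, le_rfl⟩) hM₀
  have hlog1 : |Real.log (β θ + S)| = 0 := by rw [hSdef]; norm_num
  have hL : 0 ≤ |Real.log (β θ)| := abs_nonneg _
  calc ‖v θ‖ ≤ ‖v (θ + S • e)‖ + M * W θ * (|Real.log (β θ + S)| + |Real.log (β θ)|) := h1
    _ = ‖v (θ + S • e)‖ + M * W θ * |Real.log (β θ)| := by rw [hlog1, zero_add]
    _ ≤ M₀ * W θ + M * W θ * |Real.log (β θ)| := by linarith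
    _ ≤ (M₀ + 2 * M) * (1 + |Real.log (β θ)|) * W θ := by nlinarith [mul_nonneg hM hWθ, mul_nonneg hM₀ hWθ, mul_nonneg (mul_nonneg hM hWθ) hL, mul_nonneg (mul_nonneg hM₀ hWθ) hL]

/-- **(C) THE LOGARITHMIC PASS `P_log ⟹ P 0`.**  Same setting; if `‖w‖ ≤ M·(1 + |log β|)·W` and `‖v‖ ≤ M₀·(1 + |log β|)·W` on `T`, then `‖v‖ ≤ (M₀ + 3M)·W` on `T`.
[cite: WarnerHASSLG2, §8.4.3 (proof of Thm. 8.4.3.1)] -/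
theorem norm_le_weight_of_lineDeriv_log (v w : V → E) (β : V →ₗ[ℝ] ℝ) (e : V) (hβe : β e = 1) (T : Set V) (hT : ∀ θ ∈ T, 0 < β θ ∧ β θ ≤ 1)
    (hseg : ∀ θ ∈ T, ∀ s ∈ Icc (0 : ℝ) (1 - β θ), θ + s • e ∈ T) (W : V → ℝ) (hW0 : ∀ θ ∈ T, 0 ≤ W θ)
    (hWmono : ∀ θ ∈ T, ∀ s ∈ Icc (0 : ℝ) (1 - β θ), W (θ + s • e) ≤ W θ)
    (hv : ∀ θ ∈ T, ∀ s ∈ Icc (0 : ℝ) (1 - β θ), HasDerivAt (fun s : ℝ => v (θ + s • e)) (w (θ + s • e)) s)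
    {M₀ M : ℝ} (hM₀ : 0 ≤ M₀) (hM : 0 ≤ M) (hv0 : ∀ θ ∈ T, ‖v θ‖ ≤ M₀ * (1 + |Real.log (β θ)|) * W θ)
    (hw : ∀ θ ∈ T, ‖w θ‖ ≤ M * (1 + |Real.log (β θ)|) * W θ) :
    ∀ θ ∈ T, ‖v θ‖ ≤ (M₀ + 3 * M) * W θ := by
  intro θ hθ
  obtain ⟨hb, hb1⟩ := hT θ hθ
  have hWθ := hW0 θ hθ
  set S : ℝ := 1 - β θ with hSdef
  have hS : 0 ≤ S := by linarith
  have bound : ∀ s ∈ Icc (0 : ℝ) S, ‖w (θ + s • e)‖ ≤ M * W θ * (1 + |Real.log (β (θ + s • e))|) := by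
    intro s hs
    have hmem := hseg θ hθ s hs
    refine (hw _ hmem).trans ?_
    have hpos : 0 ≤ 1 + |Real.log (β (θ + s • e))| := by positivity
    calc M * (1 + |Real.log (β (θ + s • e))|) * W (θ + s • e) ≤ M * (1 + |Real.log (β (θ + s • e))|) * W θ :=
          mul_le_mul_of_nonneg_left (hWmono θ hθ s hs) (mul_nonneg hM hpos)
      _ = M * W θ * (1 + |Real.log (β (θ + s • e))|) := by ring
  have h1 := norm_le_of_norm_lineDeriv_le_log v w β θ e hβe hb (by rw [hSdef]; linarith) hS (mul_nonneg hM hWθ) (hv θ hθ) bound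
  have hexit_mem : θ + S • e ∈ T := hseg θ hθ S ⟨hS, le_rfl⟩
  have hβexit : β (θ + S • e) = 1 := by rw [linearForm_add_smul β θ e hβe, hSdef]; ring
  have h2 : ‖v (θ + S • e)‖ ≤ M₀ * W θ := by
    refine (hv0 _ hexit_mem).trans ?_
    rw [hβexit, Real.log_one, abs_zero, add_zero, mul_one]
    exact mul_le_mul_of_nonneg_left (hWmono θ hθ S ⟨hS, le_rfl⟩) hM₀
  calc ‖v θ‖ ≤ ‖v (θ + S • e)‖ + 3 * (M * W θ) := h1
    _ ≤ M₀ * W θ + 3 * (M * W θ) := by linarith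
    _ = (M₀ + 3 * M) * W θ := by ring

end OnePass

/-! ### §2 The bootstrap: a `∂_e`-closed family with a uniform polynomial loss is bounded up to the weight -/

section Family

/-- **(A) FOR A FAMILY**: `(∀ i, ‖v i‖ ≤ M_i·β^{−(n+2)}·W) ⟹ (∀ i, ‖v i‖ ≤ M′_i·β^{−(n+1)}·W)` when `∂_e v i = v (next i)` along the exit segments. [cite: WarnerHASSLG2, §8.4.3 (proof of Thm. 8.4.3.1)] -/
theorem family_inv_pow_succ_of_inv_pow_succ_succ (v : ι → V → E) (next : ι → ι) (β : V →ₗ[ℝ] ℝ) (e : V) (hβe : β e = 1) (T : Set V)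
    (hT : ∀ θ ∈ T, 0 < β θ ∧ β θ ≤ 1) (hseg : ∀ θ ∈ T, ∀ s ∈ Icc (0 : ℝ) (1 - β θ), θ + s • e ∈ T) (W : V → ℝ) (hW0 : ∀ θ ∈ T, 0 ≤ W θ)
    (hWmono : ∀ θ ∈ T, ∀ s ∈ Icc (0 : ℝ) (1 - β θ), W (θ + s • e) ≤ W θ)
    (hderiv : ∀ i, ∀ θ ∈ T, ∀ s ∈ Icc (0 : ℝ) (1 - β θ), HasDerivAt (fun s : ℝ => v i (θ + s • e)) (v (next i) (θ + s • e)) s)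
    (n : ℕ) (h : ∀ i, ∃ M : ℝ, 0 ≤ M ∧ ∀ θ ∈ T, ‖v i θ‖ ≤ M * ((β θ) ^ (n + 2))⁻¹ * W θ) :
    ∀ i, ∃ M : ℝ, 0 ≤ M ∧ ∀ θ ∈ T, ‖v i θ‖ ≤ M * ((β θ) ^ (n + 1))⁻¹ * W θ := by
  intro i
  obtain ⟨M₀, hM₀, hv0⟩ := h i
  obtain ⟨M, hM, hw⟩ := h (next i)
  exact ⟨M₀ + M / (n + 1), by positivity,
    norm_le_inv_pow_weight_of_lineDeriv (v i) (v (next i)) β e hβe T hT hseg W hW0 hWmono (hderiv i) n hM₀ hM hv0 hw⟩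

/-- **(B) FOR A FAMILY**: `(∀ i, ‖v i‖ ≤ M_i·β⁻¹·W) ⟹ (∀ i, ‖v i‖ ≤ M′_i·(1 + |log β|)·W)`. [cite: WarnerHASSLG2, §8.4.3 (proof of Thm. 8.4.3.1)] -/
theorem family_log_of_inv (v : ι → V → E) (next : ι → ι) (β : V →ₗ[ℝ] ℝ) (e : V) (hβe : β e = 1) (T : Set V)
    (hT : ∀ θ ∈ T, 0 < β θ ∧ β θ ≤ 1) (hseg : ∀ θ ∈ T, ∀ s ∈ Icc (0 : ℝ) (1 - β θ), θ + s • e ∈ T) (W : V → ℝ) (hW0 : ∀ θ ∈ T, 0 ≤ W θ)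
    (hWmono : ∀ θ ∈ T, ∀ s ∈ Icc (0 : ℝ) (1 - β θ), W (θ + s • e) ≤ W θ)
    (hderiv : ∀ i, ∀ θ ∈ T, ∀ s ∈ Icc (0 : ℝ) (1 - β θ), HasDerivAt (fun s : ℝ => v i (θ + s • e)) (v (next i) (θ + s • e)) s)
    (h : ∀ i, ∃ M : ℝ, 0 ≤ M ∧ ∀ θ ∈ T, ‖v i θ‖ ≤ M * (β θ)⁻¹ * W θ) :
    ∀ i, ∃ M : ℝ, 0 ≤ M ∧ ∀ θ ∈ T, ‖v i θ‖ ≤ M * (1 + |Real.log (β θ)|) * W θ := by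
  intro i
  obtain ⟨M₀, hM₀, hv0⟩ := h i
  obtain ⟨M, hM, hw⟩ := h (next i)
  exact ⟨M₀ + 2 * M, by positivity, norm_le_log_weight_of_lineDeriv (v i) (v (next i)) β e hβe T hT hseg W hW0 hWmono (hderiv i) hM₀ hM hv0 hw⟩

/-- **(C) FOR A FAMILY**: `(∀ i, ‖v i‖ ≤ M_i·(1 + |log β|)·W) ⟹ (∀ i, ‖v i‖ ≤ M′_i·W)`. [cite: WarnerHASSLG2, §8.4.3 (proof of Thm. 8.4.3.1)] -/
theorem family_weight_of_log (v : ι → V → E) (next : ι → ι) (β : V →ₗ[ℝ] ℝ) (e : V) (hβe : β e = 1) (T : Set V)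
    (hT : ∀ θ ∈ T, 0 < β θ ∧ β θ ≤ 1) (hseg : ∀ θ ∈ T, ∀ s ∈ Icc (0 : ℝ) (1 - β θ), θ + s • e ∈ T) (W : V → ℝ) (hW0 : ∀ θ ∈ T, 0 ≤ W θ)
    (hWmono : ∀ θ ∈ T, ∀ s ∈ Icc (0 : ℝ) (1 - β θ), W (θ + s • e) ≤ W θ)
    (hderiv : ∀ i, ∀ θ ∈ T, ∀ s ∈ Icc (0 : ℝ) (1 - β θ), HasDerivAt (fun s : ℝ => v i (θ + s • e)) (v (next i) (θ + s • e)) s)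
    (h : ∀ i, ∃ M : ℝ, 0 ≤ M ∧ ∀ θ ∈ T, ‖v i θ‖ ≤ M * (1 + |Real.log (β θ)|) * W θ) :
    ∀ i, ∃ M : ℝ, 0 ≤ M ∧ ∀ θ ∈ T, ‖v i θ‖ ≤ M * W θ := by
  intro i
  obtain ⟨M₀, hM₀, hv0⟩ := h i
  obtain ⟨M, hM, hw⟩ := h (next i)
  exact ⟨M₀ + 3 * M, by positivity, norm_le_weight_of_lineDeriv_log (v i) (v (next i)) β e hβe T hT hseg W hW0 hWmono (hderiv i) hM₀ hM hv0 hw⟩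

/-- **THE BOOTSTRAP (Harish-Chandra ∕ Warner): A UNIFORM POLYNOMIAL LOSS FOR A `∂_e`-CLOSED FAMILY IS NO LOSS.**  Region `T ⊆ {0 < β ≤ 1}` closed under the exit segments
`θ + s•e` (`0 ≤ s ≤ 1 − β θ`, `β e = 1`); weight `W ≥ 0` non-increasing along them; family `v : ι → V → E` with `∂_e (v i) = v (next i)` along the segments.  If for ONE `n` every member
satisfies `‖v i θ‖ ≤ M_i·(β θ)^{−n}·W θ` on `T`, then every member satisfies `‖v i θ‖ ≤ M′_i·W θ` on `T`. [cite: WarnerHASSLG2, §8.4.3, Thm. 8.4.3.1 (proof, induction on `r`)] -/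
theorem forall_norm_le_weight_of_uniform_loss (v : ι → V → E) (next : ι → ι) (β : V →ₗ[ℝ] ℝ) (e : V) (hβe : β e = 1) (T : Set V)
    (hT : ∀ θ ∈ T, 0 < β θ ∧ β θ ≤ 1) (hseg : ∀ θ ∈ T, ∀ s ∈ Icc (0 : ℝ) (1 - β θ), θ + s • e ∈ T) (W : V → ℝ) (hW0 : ∀ θ ∈ T, 0 ≤ W θ)
    (hWmono : ∀ θ ∈ T, ∀ s ∈ Icc (0 : ℝ) (1 - β θ), W (θ + s • e) ≤ W θ)
    (hderiv : ∀ i, ∀ θ ∈ T, ∀ s ∈ Icc (0 : ℝ) (1 - β θ), HasDerivAt (fun s : ℝ => v i (θ + s • e)) (v (next i) (θ + s • e)) s)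
    (n : ℕ) (h : ∀ i, ∃ M : ℝ, 0 ≤ M ∧ ∀ θ ∈ T, ‖v i θ‖ ≤ M * ((β θ) ^ n)⁻¹ * W θ) :
    ∀ i, ∃ M : ℝ, 0 ≤ M ∧ ∀ θ ∈ T, ‖v i θ‖ ≤ M * W θ := by
  induction n with
  | zero =>
    intro i
    obtain ⟨M, hM, hb⟩ := h i
    exact ⟨M, hM, fun θ hθ => by simpa using hb θ hθ⟩
  | succ n ih =>
    cases n with
    | zero =>
      -- loss `1`: logarithm, then bounded
      refine family_weight_of_log v next β e hβe T hT hseg W hW0 hWmono hderiv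
        (family_log_of_inv v next β e hβe T hT hseg W hW0 hWmono hderiv fun i => ?_)
      obtain ⟨M, hM, hb⟩ := h i
      exact ⟨M, hM, fun θ hθ => by simpa using hb θ hθ⟩
    | succ n =>
      -- loss `n + 2 ↦ n + 1`, then the induction hypothesis
      exact ih (family_inv_pow_succ_of_inv_pow_succ_succ v next β e hβe T hT hseg W hW0 hWmono hderiv n h)

/-- **THE BOOTSTRAP WITHOUT WEIGHT** (`W = 1`): a `∂_e`-closed family with `‖v i‖ ≤ M_i·β^{−n}` on `T` is bounded on `T`, member by member. [cite: WarnerHASSLG2, §8.4.3, Thm. 8.4.3.1] -/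
theorem forall_norm_le_of_uniform_loss (v : ι → V → E) (next : ι → ι) (β : V →ₗ[ℝ] ℝ) (e : V) (hβe : β e = 1) (T : Set V)
    (hT : ∀ θ ∈ T, 0 < β θ ∧ β θ ≤ 1) (hseg : ∀ θ ∈ T, ∀ s ∈ Icc (0 : ℝ) (1 - β θ), θ + s • e ∈ T)
    (hderiv : ∀ i, ∀ θ ∈ T, ∀ s ∈ Icc (0 : ℝ) (1 - β θ), HasDerivAt (fun s : ℝ => v i (θ + s • e)) (v (next i) (θ + s • e)) s)
    (n : ℕ) (h : ∀ i, ∃ M : ℝ, 0 ≤ M ∧ ∀ θ ∈ T, ‖v i θ‖ ≤ M * ((β θ) ^ n)⁻¹) :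
    ∀ i, ∃ M : ℝ, 0 ≤ M ∧ ∀ θ ∈ T, ‖v i θ‖ ≤ M := by
  have h1 := forall_norm_le_weight_of_uniform_loss v next β e hβe T hT hseg (fun _ => (1 : ℝ)) (fun _ _ => zero_le_one) (fun _ _ _ _ => le_rfl)
    hderiv n (fun i => by obtain ⟨M, hM, hb⟩ := h i; exact ⟨M, hM, fun θ hθ => by simpa using hb θ hθ⟩)
  intro i
  obtain ⟨M, hM, hb⟩ := h1 i
  exact ⟨M, hM, fun θ hθ => by simpa using hb θ hθ⟩

end Family

/-! ### §3 Two walls: a sector chamber with losses `β^{−n}·β′^{−n′}` -/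

section TwoWalls

/-- The transverse weight `(β′)^{−n′}` is non-increasing along `e` when `β′ e ≥ 0` (the second wall recedes). [cite: WarnerHASSLG2, §8.4.3] -/
theorem inv_pow_linearForm_add_smul_le (β' : V →ₗ[ℝ] ℝ) (θ e : V) (he : 0 ≤ β' e) (hθ : 0 < β' θ) {s : ℝ} (hs : 0 ≤ s) (n' : ℕ) :
    ((β' (θ + s • e)) ^ n')⁻¹ ≤ ((β' θ) ^ n')⁻¹ := by
  have hle : β' θ ≤ β' (θ + s • e) := by
    simp only [map_add, map_smul, smul_eq_mul]
    nlinarith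
  exact inv_anti₀ (pow_pos hθ _) (pow_le_pow_left₀ hθ.le hle _)

/-- **TWO WALLS (the sector chamber).**  `β, β′` linear, directions `e, e′` with `β e = 1`, `β′ e′ = 1`, `β′ e ≥ 0` (the first exit direction does not approach the second wall; NO
condition on `β e′` is needed — after the first stage no `β`-loss is left); `T ⊆ {0 < β ≤ 1} ∩ {0 < β′ ≤ 1}` closed under BOTH exit families; a family `v` closed under `∂_e` (via `next`) and under `∂_{e′}` (via `next′`).  If for ONE pair `(n, n′)` every member has
`‖v i θ‖ ≤ M_i·(β θ)^{−n}·(β′ θ)^{−n′}` on `T`, then every member is BOUNDED on `T`.  (Warner's induction on `(r, r′)` for `{∂(q)φ_f}` on a chamber with two noncompact root walls.)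
[cite: WarnerHASSLG2, §8.4.3, Thm. 8.4.3.1 (proof)] -/
theorem forall_norm_le_of_uniform_loss_two_walls (v : ι → V → E) (next next' : ι → ι) (β β' : V →ₗ[ℝ] ℝ) (e e' : V) (hβe : β e = 1) (hβ'e' : β' e' = 1)
    (hβ'e : 0 ≤ β' e) (T : Set V) (hT : ∀ θ ∈ T, 0 < β θ ∧ β θ ≤ 1) (hT' : ∀ θ ∈ T, 0 < β' θ ∧ β' θ ≤ 1)
    (hseg : ∀ θ ∈ T, ∀ s ∈ Icc (0 : ℝ) (1 - β θ), θ + s • e ∈ T) (hseg' : ∀ θ ∈ T, ∀ s ∈ Icc (0 : ℝ) (1 - β' θ), θ + s • e' ∈ T)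
    (hderiv : ∀ i, ∀ θ ∈ T, ∀ s ∈ Icc (0 : ℝ) (1 - β θ), HasDerivAt (fun s : ℝ => v i (θ + s • e)) (v (next i) (θ + s • e)) s)
    (hderiv' : ∀ i, ∀ θ ∈ T, ∀ s ∈ Icc (0 : ℝ) (1 - β' θ), HasDerivAt (fun s : ℝ => v i (θ + s • e')) (v (next' i) (θ + s • e')) s)
    (n n' : ℕ) (h : ∀ i, ∃ M : ℝ, 0 ≤ M ∧ ∀ θ ∈ T, ‖v i θ‖ ≤ M * ((β θ) ^ n)⁻¹ * ((β' θ) ^ n')⁻¹) :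
    ∀ i, ∃ M : ℝ, 0 ≤ M ∧ ∀ θ ∈ T, ‖v i θ‖ ≤ M := by
  -- stage 1: along `e`, weight `W = (β′)^{−n′}`
  have stage1 := forall_norm_le_weight_of_uniform_loss v next β e hβe T hT hseg (fun θ => ((β' θ) ^ n')⁻¹)
    (fun θ hθ => inv_nonneg.2 (pow_nonneg (hT' θ hθ).1.le _))
    (fun θ hθ s hs => inv_pow_linearForm_add_smul_le β' θ e hβ'e (hT' θ hθ).1 hs.1 n') hderiv n h
  -- stage 2: along `e′`, no weight
  exact forall_norm_le_of_uniform_loss v next' β' e' hβ'e' T hT' hseg' hderiv' n' stage1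

end TwoWalls

end Literature.Analysis.Calculus.LineBootstrap

end
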